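import Literature.AlgebraicGeometry.HodgeTheory.FermatOddMiddleBettiNumber
import Literature.AlgebraicGeometry.HodgeTheory.SmoothPlaneCurveGenus
import HarnessLib

/-!
# The character lines of the Fermat CURVE: `V(α) ≠ 0` on `𝔄¹ₘ`, `dim V(α) = 1` (Shioda 1979 §1 (1.3)–(1.4), the case `n = 1`)

Family `hodge`, layer `Literature/AlgebraicGeometry/HodgeTheory`. PROOF FILE (theorems only: no definition, no named
fact, no instance; D-0026 net debt `0`). T. Shioda, *The Hodge conjecture for Fermat varieties*, Math. Ann. 245
(1979), §1 (1.3)–(1.4): "`Hⁿ_prim(Xⁿₘ, ℂ) = ⊕_{α ∈ 𝔄ⁿₘ} V(α)`, `dim V(α) = 1`". The tree proves the existence half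
`V(α) ≠ 0` in even dimension (`fermatEigenspace_ne_bot`) and in odd dimension `2p + 1 ≥ 3`
(`fermatEigenspace_ne_bot_odd`, whose hyperplane-section count needs `p ≥ 1`). This file closes the remaining case
`n = 1`, the Fermat CURVE `X¹ₘ : x₀ᵐ + x₁ᵐ + x₂ᵐ = 0`, by a different (cheaper) count: the tree KNOWS
`b₁(X¹ₘ) = (m−1)(m−2)` (`finrank_bettiCohomology_one_fermatCurve`, from the plane-curve sandwich of
`SmoothPlaneCurveGenus`) and `|𝔄¹ₘ| = (m−1)(m−2)` (`card_fermatAdmissible_three_eq`); since `H¹ = ⊕_α V(α)` with every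
`V(α)` at most a line and `0` off `𝔄¹ₘ` (`fermatEigenspace_le_span_odd`, `fermatEigenspace_eq_bot_odd_of_apply_eq_zero`,
`fermatEigenspace_eq_bot_of_sum_ne_zero` at `p = 0`), a single vanishing admissible line would force `b₁ ≤ |𝔄¹ₘ| − 1`.

* `sum_finrank_fermatEigenspace_one_eq` — `Σ_α dim V(α) = b₁(X¹ₘ) = (m−1)(m−2)`.
* **`fermatEigenspace_ne_bot_one`**, `finrank_fermatEigenspace_one_eq_one` — `V(α) ≠ 0`, `dim V(α) = 1` on `𝔄¹ₘ`.
* `fermatEigenspace_ne_bot_odd'` — `V(α) ≠ 0` on `𝔄²ᵖ⁺¹ₘ` for EVERY `p` (so, with `fermatEigenspace_ne_bot`, Shioda's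
  existence half holds in every dimension in the tree).

Written by the prover seat `hodge-nonav-19716-p2` (g5, cell `hodge-nonav`), closing the `p = 0` TODO of its files
`FermatEigenspaceNonvanishingOdd` ∕ `FermatOddMiddleBettiNumber`.

## References

* [Shioda1979HodgeFermat] T. Shioda, The Hodge conjecture for Fermat varieties, Math. Ann. 245 (1979) 175–184, §1 (1.3)–(1.4).
* [Hartshorne1977] R. Hartshorne, Algebraic Geometry (1977), V Example 1.5.1 (genus of a plane curve).
-/

noncomputable section

open CategoryTheory AlgebraicGeometry

namespace Literature.AlgebraicGeometry.HodgeTheory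

open Literature.AlgebraicGeometry.Motives Literature.AlgebraicTopology.SingularHomology

variable {m : ℕ}

/-- `dim (⨆ᵢ Aᵢ) = Σᵢ dim Aᵢ` for an independent finite family of subspaces (plumbing). [folklore] -/
private theorem finrank_iSup_eq_sum_of_iSupIndep'' {K M : Type*} [Field K] [AddCommGroup M] [Module K M]
    {ι : Type*} [Fintype ι] (B : ι → Submodule K M) (hB : iSupIndep B) [∀ i, Module.Finite K (B i)] :
    Module.finrank K ↥(⨆ i, B i) = ∑ i, Module.finrank K (B i) := by
  classical
  have hinj := hB.dfinsupp_lsum_injective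
  have hrange : LinearMap.range (DFinsupp.lsum ℕ (M := fun i => ↥(B i)) fun i => (B i).subtype) = ⨆ i, B i :=
    (Submodule.iSup_eq_range_dfinsupp_lsum B).symm
  rw [← hrange, LinearMap.finrank_range_of_inj hinj, ← Module.finrank_directSum]
  rfl

/-- **`Σ_α dim V(α) = b₁(X¹ₘ) = (m−1)(m−2)`** for the Fermat curve (`m ≥ 1`): the character decomposition
`H¹(X¹ₘ(ℂ); ℂ) = ⊕_α V(α)` (`isInternal_fermatEigenspace`) and the plane-curve Betti number
(`finrank_bettiCohomology_one_fermatCurve`, universal coefficients). [cite: Shioda1979HodgeFermat, §1 (1.3)–(1.4)]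
[cite: Hartshorne1977, V Example 1.5.1] -/
theorem sum_finrank_fermatEigenspace_one_eq [NeZero m] :
    ∑ α : Fin (0 + 2 + 1) → ZMod m, Module.finrank ℂ ↥(fermatEigenspace m α (2 * 0 + 1)) = (m - 1) * (m - 2) := by
  classical
  have hm : 1 ≤ m := NeZero.one_le
  have hX : IsSmoothProjective 1 (fermatHypersurface 1 m) := isSmoothProjective_fermatHypersurface le_rfl hm
  haveI := finite_complexBetti hX 1
  have hind := iSupIndep_fermatEigenspace (n := 1) (m := m) 1
  have htop := iSup_fermatEigenspace_eq_top (n := 1) (m := m) 1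
  have h1 : ∑ α : Fin (1 + 2) → ZMod m, Module.finrank ℂ ↥(fermatEigenspace m α 1) =
      Module.finrank ℂ (complexBetti (fermatHypersurface 1 m) 1) := by
    rw [← finrank_iSup_eq_sum_of_iSupIndep'' _ hind, htop, finrank_top]
  have h2 : Module.finrank ℂ (complexBetti (fermatHypersurface 1 m) 1) =
      Module.finrank ℚ (bettiCohomology (fermatHypersurface 1 m) 1) := by
    change Module.finrank ℂ (singularCohomology ℂ ℂ (ComplexPoints (fermatHypersurface 1 m)) 1) =
      Module.finrank ℚ (singularCohomology ℚ ℚ (ComplexPoints (fermatHypersurface 1 m)) 1)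
    rw [finrank_singularCohomology_eq_bettiNumber_of_field, finrank_singularCohomology_eq_bettiNumber_of_field,
      bettiNumber_eq_of_algebra ℚ ℂ]
  have h3 := finrank_bettiCohomology_one_fermatCurve exists_isReal_hodgeModel_holds m
  exact h1.trans (h2.trans h3)

/-- **`V(α) ≠ 0` for every admissible character of the Fermat CURVE** (`m ≥ 1`; `α = (α₀, α₁, α₂)`, all `αᵢ ≠ 0`,
`Σ αᵢ = 0`): otherwise `b₁ = Σ_β dim V(β) ≤ |𝔄¹ₘ| − 1` (every `V(β)` is at most a line and vanishes off `𝔄¹ₘ`),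
contradicting `b₁ = |𝔄¹ₘ| = (m−1)(m−2)`. [cite: Shioda1979HodgeFermat, §1 (1.3)–(1.4)] -/
theorem fermatEigenspace_ne_bot_one [NeZero m] {α : Fin (2 * 0 + 3) → ZMod m} (hα : ∀ i, α i ≠ 0)
    (hαs : ∑ i, α i = 0) : fermatEigenspace m α (2 * 0 + 1) ≠ ⊥ := by
  classical
  intro hbot
  have hm : 1 ≤ m := NeZero.one_le
  have hX : IsSmoothProjective 1 (fermatHypersurface 1 m) := isSmoothProjective_fermatHypersurface le_rfl hm
  haveI := finite_complexBetti hX 1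
  -- every `V(β)` has dimension ≤ the indicator of `𝔄 ∖ {α}`
  have hle : ∀ β : Fin (2 * 0 + 3) → ZMod m, Module.finrank ℂ ↥(fermatEigenspace m β (2 * 0 + 1)) ≤
      if ((∀ i, β i ≠ 0) ∧ ∑ i, β i = 0) ∧ β ≠ α then 1 else 0 := by
    intro β
    split_ifs with h
    · obtain ⟨v, hv⟩ := fermatEigenspace_le_span_odd hm 0 β
      calc Module.finrank ℂ ↥(fermatEigenspace m β (2 * 0 + 1)) ≤ Module.finrank ℂ ↥(ℂ ∙ v) := Submodule.finrank_mono hv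
        _ ≤ ({v} : Set (complexBetti (fermatHypersurface (2 * 0 + 1) m) (2 * 0 + 1))).toFinset.card :=
            finrank_span_le_card _
        _ = 1 := by simp
    · rw [Nat.le_zero, Submodule.finrank_eq_zero]
      by_cases hβα : β = α
      · rw [hβα]; exact hbot
      · have hgood : ¬ ((∀ i, β i ≠ 0) ∧ ∑ i, β i = 0) := fun hg ↦ h ⟨hg, hβα⟩
        rw [not_and_or] at hgood
        rcases hgood with h1 | h2
        · push Not at h1
          obtain ⟨i, hi⟩ := h1
          exact fermatEigenspace_eq_bot_odd_of_apply_eq_zero hm 0 hi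
        · exact fermatEigenspace_eq_bot_of_sum_ne_zero h2 _
  have hsum := Finset.sum_le_sum fun β (_ : β ∈ Finset.univ) ↦ hle β
  rw [sum_finrank_fermatEigenspace_one_eq, Finset.sum_boole] at hsum
  -- the indicator sum is `|𝔄¹ₘ| − 1 < |𝔄¹ₘ| = (m−1)(m−2)`
  have hcardA : (Finset.univ.filter fun β : Fin (2 * 0 + 3) → ZMod m ↦ (∀ i, β i ≠ 0) ∧ ∑ i, β i = 0).card =
      (m - 1) * (m - 2) := by
    rw [← Fintype.card_subtype]; exact card_fermatAdmissible_three_eq m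
  have hsub : (Finset.univ.filter fun β : Fin (2 * 0 + 3) → ZMod m ↦ ((∀ i, β i ≠ 0) ∧ ∑ i, β i = 0) ∧ β ≠ α).card + 1 =
      (Finset.univ.filter fun β : Fin (2 * 0 + 3) → ZMod m ↦ (∀ i, β i ≠ 0) ∧ ∑ i, β i = 0).card := by
    rw [← Finset.filter_filter, Finset.filter_ne', Finset.card_erase_add_one]
    exact Finset.mem_filter.mpr ⟨Finset.mem_univ _, hα, hαs⟩
  simp only [Nat.cast_id] at hsum
  omega

/-- **`dim V(α) = 1` on `𝔄¹ₘ`** for the Fermat curve. [cite: Shioda1979HodgeFermat, §1 (1.3)–(1.4)] -/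
theorem finrank_fermatEigenspace_one_eq_one [NeZero m] {α : Fin (2 * 0 + 3) → ZMod m} (hα : ∀ i, α i ≠ 0)
    (hαs : ∑ i, α i = 0) : Module.finrank ℂ ↥(fermatEigenspace m α (2 * 0 + 1)) = 1 := by
  have hm : 1 ≤ m := NeZero.one_le
  have hX : IsSmoothProjective 1 (fermatHypersurface 1 m) := isSmoothProjective_fermatHypersurface le_rfl hm
  haveI := finite_complexBetti hX 1
  obtain ⟨v, hv⟩ := fermatEigenspace_le_span_odd hm 0 α
  refine le_antisymm ?_ ?_
  · calc Module.finrank ℂ ↥(fermatEigenspace m α (2 * 0 + 1)) ≤ Module.finrank ℂ ↥(ℂ ∙ v) := Submodule.finrank_mono hv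
      _ ≤ ({v} : Set (complexBetti (fermatHypersurface (2 * 0 + 1) m) (2 * 0 + 1))).toFinset.card :=
          finrank_span_le_card _
      _ = 1 := by simp
  · rw [Nat.one_le_iff_ne_zero, Ne, Submodule.finrank_eq_zero]
    exact fermatEigenspace_ne_bot_one hα hαs

/-- **`V(α) ≠ 0` on `𝔄²ᵖ⁺¹ₘ` for EVERY `p`** (`m ≥ 1`): the curve case `p = 0` above, `p ≥ 1` by
`fermatEigenspace_ne_bot_odd`. With the even-dimensional `fermatEigenspace_ne_bot`, Shioda's existence half
"`dim V(α) = 1` for `α ∈ 𝔄ⁿₘ`" now holds in every dimension `n ≥ 1`. [cite: Shioda1979HodgeFermat, §1 (1.3)–(1.4)] -/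
theorem fermatEigenspace_ne_bot_odd' [NeZero m] (p : ℕ) {α : Fin (2 * p + 3) → ZMod m} (hα : ∀ i, α i ≠ 0)
    (hαs : ∑ i, α i = 0) : fermatEigenspace m α (2 * p + 1) ≠ ⊥ := by
  rcases Nat.eq_zero_or_pos p with rfl | hp
  · exact fermatEigenspace_ne_bot_one hα hαs
  · exact fermatEigenspace_ne_bot_odd hp hα hαs

end Literature.AlgebraicGeometry.HodgeTheory

end
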